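import Summits.HubbardSuperconductivity.HubbardSuperconductivity.Theorems.BirComplexStableXYR.Negative.ComplexInhabitant
import Literature.Analysis.Fourier.TorusExpNonnegCoefficients
import HarnessLib

/-!
# Crux `BirComplexStableXYR` (stmt-HubbardSuperconductivity-14845): conclusion 1 (`Z ≠ 0`) holds outright on
# the COMPLEX Fourier-negative cone — genuinely complex, time-odd actions included

Support theorem for the restated engine of route BalabanIR (crux 2R,
`Summit.HubbardSuperconductivity.HubbardSuperconductivity.Theses.BalabanIR.BirComplexStableXYR`), prover seat 0.
The crux asks, uniformly over a class of COMPLEX coercive window tables `c`, for `K₀, L₀` with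
`Z ≠ 0 ∧ Re(∫ O e^{-A}/Z) ≥ 1/2`; its reshaped line (lead c6) isolates the first conjunct as the stub
`stub_complexPositivityI3` (`0 < Re Z`, open for `r ≥ 3`: the sign problem of a complex measure).

**What is proved here.**  Call a table `c` *Fourier-negative* if every NON-CONSTANT coefficient is a
non-positive real, `Im c_n = 0 ∧ Re c_n ≤ 0` for `n ≠ 0` — NO symmetry `c_{-n} = c_n` is assumed, so the local
generating function `F = Σ_n c_n e^{i n·φ}` is in general genuinely complex (e.g. the imaginary temporal current
`i g sin ∂_τφ` next to `-J cos ∂_τφ` has coefficients `-(J∓g)/2`, Fourier-negative iff `|g| ≤ J`).  Then for EVERY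
window size `r`, every stiffness `K ≥ 0` and every torus `(ℤ/L)² × ℤ/M` (no `K₀`, no `L₀`, no parity, no `L ≤ M`,
and none of (U1), (N), (A), (C), (R), (P)):

* `cplxFerro_partZ_eq` — `Z = exp(-K |Λ| c_0) · R` with a REAL `R ≥ (2π)^{|Λ|}`;
* `cplxFerro_partZ_ne_zero` — hence `Z ≠ 0` (conclusion 1 of the crux), and
  `cplxFerro_re_partZ_pos` — `0 < Re Z`, `Im Z = 0` as soon as `c_0` is real (e.g. under (N) + the cone);
* `birComplexStableXYR_conclusion1_complexFerroCone` — the same with the crux's `let`-bound `sh, F, A, cube, Z`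
  spelled out verbatim;
* `tiltedXY_mem_complexFerroCone`, `cplxFerro_re_partZ_tiltedXY_pos` — the standing disprover's GENUINELY
  COMPLEX class member, the Berry-tilted XY table `witness 0 ε₂` (`Σ_{12 cube edges}(1 - cos Δ_eφ) +
  iε₂ Σ_{4 temporal edges} sin Δ_eφ`, in the (U1)(N)(A)(C)(R)(P) class for `|ε₂| ≤ 1/5` by
  `Negative.tiltedXY_mem_classRP`, non-real by `Negative.genF_tiltedXY_not_real`), lies in the cone for
  `|ε₂| ≤ 1`, so ITS partition function is a positive real at every `K ≥ 0`, `L`, `M`.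

**Why it is true.**  `-A(θ) = -K|Λ|c_0 + Σ_{s ∈ Λ} Σ_{n ≠ 0} (-K Re c_n) · e^{i (sh_s)_* n · θ}` is a constant
plus a trigonometric polynomial on `[0,2π]^Λ` with NON-NEGATIVE coefficients, and the Fourier coefficients of
the exponential of such a polynomial are non-negative reals with constant coefficient `≥ (2π)^{|Λ|}`
(`Literature.Analysis.Fourier.integral_cexp_const_add_sum`, the torus case of "exp of a positive-definite
function is positive-definite"; equivalently: the character/current expansion of `e^{-A}` has non-negative
weights).  No reflection positivity, transfer matrix or expansion is involved.

**What this says for the crux.**  Together with the real ferromagnetic cone (`…FerroCone.lean`, which needs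
`c_{-n} = c_n` and gets BOTH conjuncts by Ginibre comparison) this locates the sign problem of S5a exactly: a
table can endanger `Z ≠ 0` only through a non-constant coefficient OUTSIDE `ℝ_{≤0}` (a mixed-sign real
remainder allowed by (C), or a non-real coefficient such as `± iγ` on an (R)-invariant frequency) that survives
every in-class re-tabling; imaginary temporal currents dominated by their cosine partners — the only explicit
complex inhabitant of the class in the tree — are harmless for conjunct 1 at all `K, L, M`.  Conjunct 2 (slice
order `≥ 1/2`) is NOT addressed on the complex cone: Ginibre's monotonicity fails for complex positive-definite
weights (e.g. `∫ cos θ · e^{J e^{iθ}} dθ / ∫ e^{J e^{iθ}} dθ = J/2`, unbounded in `J`).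

All objects are the named verbatim pieces `genF`, `ch`, `sh`, `action`, `cube`, `partZ`, `witness`, `cosTab`,
`sinTab`, `dfreq` of `Theorems.BirComplexStableXY.Negative.WitnessTable`; no definition is introduced.
References: J. Ginibre, Comm. Math. Phys. 16 (1970) 310–328 (positive-definite interactions) [Ginibre1970];
S. Friedli, Y. Velenik, *Statistical Mechanics of Lattice Systems*, CUP 2017, §3.8 [FriedliVelenik2017].
-/

noncomputable section

namespace Summit.HubbardSuperconductivity.HubbardSuperconductivity.Theorems

open scoped BigOperators ComplexConjugate
open MeasureTheory Literature.Probability.LatticeModels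
open Summit.HubbardSuperconductivity.BirComplexStableXYNegative

section ComplexFerroCone

variable {r : ℕ}

/-! ### The action as a constant plus a non-negative trigonometric polynomial -/

/-- The trivial character is `1` (any window size). -/
theorem cplxFerro_ch_zero (φ : W r → ℝ) : ch (0 : Freq r) φ = 1 := by
  simp [ch]

/-- Splitting off the constant mode of the generating function:
`F(φ) = c_0 + Σ_{n ∈ supp c ∖ {0}} c_n e^{i n·φ}`. [folklore] -/
theorem cplxFerro_genF_split (c : Table r) (φ : W r → ℝ) :
    genF c φ = c 0 + ∑ n ∈ c.support.erase 0, c n * ch n φ := by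
  classical
  have h1 : genF c φ = ∑ n ∈ c.support, c n * ch n φ := rfl
  rw [h1]
  by_cases h0 : (0 : Freq r) ∈ c.support
  · rw [← Finset.add_sum_erase _ _ h0, cplxFerro_ch_zero, mul_one]
  · have hc0 : c 0 = 0 := by simpa [Finsupp.mem_support_iff] using h0
    rw [Finset.erase_eq_of_notMem h0, hc0, zero_add]

/-- **Push-forward of a window frequency to the torus.**  Pairing the window frequency `n` with the field read
through the window at `s` is pairing the torus frequency `x ↦ Σ_{w : sh s w = x} n_w` with the field:
`Σ_w n_w θ(sh s w) = Σ_x (Σ_{sh s w = x} n_w) θ_x` (valid also when the window wraps around a small torus).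
[folklore] -/
theorem cplxFerro_sum_window_eq_sum_sites (L M : ℕ) [NeZero L] [NeZero M] (s : Λ L M) (n : Freq r)
    (θ : Λ L M → ℝ) :
    ∑ w, (n w : ℝ) * θ (sh L M s w) =
      ∑ x, ((∑ w ∈ Finset.univ.filter (fun w => sh L M s w = x), n w : ℤ) : ℝ) * θ x := by
  classical
  rw [← Finset.sum_fiberwise Finset.univ (sh L M s) (fun w => (n w : ℝ) * θ (sh L M s w))]
  refine Finset.sum_congr rfl fun x _ => ?_
  rw [Int.cast_sum, Finset.sum_mul]
  refine Finset.sum_congr rfl fun w hw => ?_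
  rw [(Finset.mem_filter.1 hw).2]

/-- The window character read at translate `s` is the torus character of the pushed-forward frequency. -/
theorem cplxFerro_ch_window (L M : ℕ) [NeZero L] [NeZero M] (s : Λ L M) (n : Freq r) (θ : Λ L M → ℝ) :
    ch n (fun w => θ (sh L M s w)) =
      Complex.exp (Complex.I * ((∑ x,
        ((∑ w ∈ Finset.univ.filter (fun w => sh L M s w = x), n w : ℤ) : ℝ) * θ x : ℝ) : ℂ)) := by
  rw [ch, cplxFerro_sum_window_eq_sum_sites]

/-- **The Boltzmann factor of a Fourier-negative table is `exp` of a constant plus a non-negative trigonometric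
polynomial**: with `E = supp c ∖ {0}`,
`e^{-A(θ)} = exp( -K|Λ|c_0 + Σ_{(s,n) ∈ Λ × E} (-K Re c_n) e^{i (sh_s)_* n · θ} )`. [folklore] -/
theorem cplxFerro_cexp_neg_action (K : ℝ) (c : Table r) (hc : ∀ n, n ≠ 0 → (c n).im = 0 ∧ (c n).re ≤ 0)
    (L M : ℕ) [NeZero L] [NeZero M] (θ : Λ L M → ℝ) :
    Complex.exp (-(action K c L M θ)) =
      Complex.exp (-((K : ℂ) * (Fintype.card (Λ L M) : ℂ) * c 0) +
        ∑ j ∈ (Finset.univ : Finset (Λ L M)) ×ˢ (c.support.erase 0),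
          ((-(K * (c j.2).re) : ℝ) : ℂ) * Complex.exp (Complex.I * ((∑ x,
            ((∑ w ∈ Finset.univ.filter (fun w => sh L M j.1 w = x), j.2 w : ℤ) : ℝ) * θ x : ℝ) : ℂ))) := by
  classical
  congr 1
  rw [action, Finset.sum_product]
  simp_rw [cplxFerro_genF_split c, ← cplxFerro_ch_window]
  rw [Finset.sum_add_distrib, Finset.sum_const, Finset.card_univ, nsmul_eq_mul, mul_add, neg_add]
  congr 1
  · ring
  · rw [Finset.mul_sum, ← Finset.sum_neg_distrib]
    refine Finset.sum_congr rfl fun s _ => ?_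
    rw [Finset.mul_sum, ← Finset.sum_neg_distrib]
    refine Finset.sum_congr rfl fun n hn => ?_
    have hn0 : n ≠ 0 := (Finset.mem_erase.1 hn).1
    have hcn : c n = (((c n).re : ℝ) : ℂ) := Complex.ext (by simp) (by simp [(hc n hn0).1])
    conv_lhs => rw [hcn]
    push_cast
    ring

/-! ### Conclusion 1 of the crux on the complex Fourier-negative cone -/

/-- **`Z = e^{-K|Λ|c_0} · R` with `R ≥ (2π)^{|Λ|}` on the complex Fourier-negative cone.**  For every window size
`r`, every `K ≥ 0`, every table with `Im c_n = 0 ∧ Re c_n ≤ 0` for all `n ≠ 0` (no symmetry assumed: `F` may be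
non-real) and every torus `(ℤ/L)² × ℤ/M`. [cite: Ginibre1970, main theorem with the plane-rotator example] -/
theorem cplxFerro_partZ_eq (K : ℝ) (hK : 0 ≤ K) (c : Table r)
    (hc : ∀ n, n ≠ 0 → (c n).im = 0 ∧ (c n).re ≤ 0) (L M : ℕ) [NeZero L] [NeZero M] :
    ∃ R : ℝ, (2 * Real.pi) ^ Fintype.card (Λ L M) ≤ R ∧
      partZ K c L M = Complex.exp (-((K : ℂ) * (Fintype.card (Λ L M) : ℂ) * c 0)) * (R : ℂ) := by
  classical
  have hβ : ∀ j ∈ (Finset.univ : Finset (Λ L M)) ×ˢ (c.support.erase 0), 0 ≤ -(K * (c j.2).re) := by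
    intro j hj
    have hn0 : j.2 ≠ 0 := (Finset.mem_erase.1 (Finset.mem_product.1 hj).2).1
    have := (hc j.2 hn0).2
    nlinarith
  obtain ⟨R, hR, hint⟩ := Literature.Analysis.Fourier.integral_cexp_const_add_sum
    ((Finset.univ : Finset (Λ L M)) ×ˢ (c.support.erase 0))
    (-((K : ℂ) * (Fintype.card (Λ L M) : ℂ) * c 0)) (fun j => -(K * (c j.2).re)) hβ
    (fun j x => ∑ w ∈ Finset.univ.filter (fun w => sh L M j.1 w = x), j.2 w)
  refine ⟨R, hR, ?_⟩
  rw [← hint, partZ, cube]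
  refine integral_congr_ae (ae_of_all _ fun θ => ?_)
  exact cplxFerro_cexp_neg_action K c hc L M θ

/-- **Conclusion 1 of the crux on the complex Fourier-negative cone: `Z ≠ 0`** — every `r`, every `K ≥ 0`, every
`L, M`. [cite: Ginibre1970, main theorem with the plane-rotator example] -/
theorem cplxFerro_partZ_ne_zero (K : ℝ) (hK : 0 ≤ K) (c : Table r)
    (hc : ∀ n, n ≠ 0 → (c n).im = 0 ∧ (c n).re ≤ 0) (L M : ℕ) [NeZero L] [NeZero M] :
    partZ K c L M ≠ 0 := by
  obtain ⟨R, hR, hZ⟩ := cplxFerro_partZ_eq K hK c hc L M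
  have hRpos : 0 < R := lt_of_lt_of_le (by positivity) hR
  rw [hZ]
  exact mul_ne_zero (Complex.exp_ne_zero _) (by exact_mod_cast hRpos.ne')

/-- **`0 < Re Z`, `Im Z = 0` on the complex Fourier-negative cone when `c_0` is real** (as it is under (N)
`Σ c_n = 0` on the cone) — the content of the line's stub `stub_complexPositivityI3`, on this face for every
`r, K ≥ 0, L, M`. [cite: Ginibre1970, main theorem with the plane-rotator example] -/
theorem cplxFerro_re_partZ_pos (K : ℝ) (hK : 0 ≤ K) (c : Table r)
    (hc : ∀ n, n ≠ 0 → (c n).im = 0 ∧ (c n).re ≤ 0) (h0 : (c 0).im = 0) (L M : ℕ) [NeZero L] [NeZero M] :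
    0 < (partZ K c L M).re ∧ (partZ K c L M).im = 0 := by
  obtain ⟨R, hR, hZ⟩ := cplxFerro_partZ_eq K hK c hc L M
  have hRpos : 0 < R := lt_of_lt_of_le (by positivity) hR
  have hc0 : c 0 = (((c 0).re : ℝ) : ℂ) := Complex.ext (by simp) (by simp [h0])
  have hexp : Complex.exp (-((K : ℂ) * (Fintype.card (Λ L M) : ℂ) * c 0)) =
      ((Real.exp (-(K * Fintype.card (Λ L M) * (c 0).re)) : ℝ) : ℂ) := by
    conv_lhs => rw [hc0]
    rw [Complex.ofReal_exp]
    push_cast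
    ring_nf
  rw [hZ, hexp, ← Complex.ofReal_mul, Complex.ofReal_re, Complex.ofReal_im]
  exact ⟨by positivity, rfl⟩

/-- **Registered form (stub `cplxFerro_conclusion1` of stmt-HubbardSuperconductivity-14845): conclusion 1 of the crux on the
complex Fourier-negative cone.**  For every window size `r`, every `K ≥ 0`, every table whose non-constant coefficients are
non-positive reals, and every torus: `Z ≠ 0`, and `0 < Re Z`, `Im Z = 0` once `c_0` is real.
[cite: Ginibre1970, main theorem with the plane-rotator example] -/
theorem cplxFerro_conclusion1 : ∀ (r : ℕ) (K : ℝ), 0 ≤ K → ∀ c : Table r, (∀ n : Freq r, n ≠ 0 → (c n).im = 0 ∧ (c n).re ≤ 0) → ∀ (L M : ℕ) [NeZero L] [NeZero M], partZ K c L M ≠ 0 ∧ ((c 0).im = 0 → 0 < (partZ K c L M).re ∧ (partZ K c L M).im = 0) := by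
  intro r K hK c hc L M _ _
  exact ⟨cplxFerro_partZ_ne_zero K hK c hc L M, fun h0 => cplxFerro_re_partZ_pos K hK c hc h0 L M⟩

/-- **In-class re-tabling.**  `Z` depends on the table only through the torus action, so conclusion 1 holds for
every table `c` whose action on the given torus coincides with that of SOME Fourier-negative table `c'` (e.g. after
merging the coefficients of window frequencies that are translates of each other, which may cancel positive against
negative parts): the sign problem is carried only by what survives every such re-tabling. [folklore] -/
theorem cplxFerro_partZ_ne_zero_of_retable (K : ℝ) (hK : 0 ≤ K) (c c' : Table r) (L M : ℕ) [NeZero L] [NeZero M]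
    (h : ∀ θ : Λ L M → ℝ, action K c L M θ = action K c' L M θ)
    (hc' : ∀ n, n ≠ 0 → (c' n).im = 0 ∧ (c' n).re ≤ 0) :
    partZ K c L M ≠ 0 := by
  have hZ : partZ K c L M = partZ K c' L M := by
    unfold partZ
    simp_rw [h]
  rw [hZ]
  exact cplxFerro_partZ_ne_zero K hK c' hc' L M

/-- Under (N) `Σ_n c_n = 0`, a table on the cone has a real constant coefficient `c_0 = -Σ_{n≠0} c_n`. -/
theorem cplxFerro_coeff_zero_im_of_condN (c : Table r) (hc : ∀ n, n ≠ 0 → (c n).im = 0 ∧ (c n).re ≤ 0)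
    (hN : c.sum (fun _ a => a) = 0) : (c 0).im = 0 := by
  classical
  have h1 : c.sum (fun _ a => a) = ∑ n ∈ c.support, c n := rfl
  rw [h1] at hN
  by_cases h0 : (0 : Freq r) ∈ c.support
  · rw [← Finset.add_sum_erase _ _ h0] at hN
    have : c 0 = -∑ n ∈ c.support.erase 0, c n := eq_neg_of_add_eq_zero_left hN
    rw [this, Complex.neg_im, Complex.im_sum, Finset.sum_eq_zero (fun n hn => (hc n (Finset.mem_erase.1 hn).1).1),
      neg_zero]
  · have : c 0 = 0 := by simpa [Finsupp.mem_support_iff] using h0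
    simp [this]

/-- **Conclusion 1 of `BirComplexStableXYR` on the complex Fourier-negative cone, verbatim form.**  With the
crux's own `let`-bound `sh, F, A, cube, Z`: for every `r`, every `K ≥ 0`, every finitely supported table whose
non-constant coefficients are non-positive reals, and every `L, M ≥ 1`, `Z ≠ 0`; no other hypothesis of the
crux is used. [cite: Ginibre1970, main theorem with the plane-rotator example] -/
theorem birComplexStableXYR_conclusion1_complexFerroCone :
    ∀ (r : ℕ) (K : ℝ), 0 ≤ K → ∀ c : ((Fin r × Fin r × Fin r) → ℤ) →₀ ℂ,
    (∀ n : (Fin r × Fin r × Fin r) → ℤ, n ≠ 0 → (c n).im = 0 ∧ (c n).re ≤ 0) →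
    ∀ (L M : ℕ) [NeZero L] [NeZero M],
    let sh : (Literature.Probability.LatticeModels.TorusSite 2 L × ZMod M) → (Fin r × Fin r × Fin r) → (Literature.Probability.LatticeModels.TorusSite 2 L × ZMod M) := fun s w => (s.1 + ![((w.1 : ℕ) : ZMod L), ((w.2.1 : ℕ) : ZMod L)], s.2 + ((w.2.2 : ℕ) : ZMod M))
    let F : ((Fin r × Fin r × Fin r) → ℝ) → ℂ := fun (φ : (Fin r × Fin r × Fin r) → ℝ) => c.sum (fun n a => a * Complex.exp (Complex.I * ((∑ w, (n w : ℝ) * φ w : ℝ) : ℂ)))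
    let A : ((Literature.Probability.LatticeModels.TorusSite 2 L × ZMod M) → ℝ) → ℂ := fun θ => (K : ℂ) * ∑ s : (Literature.Probability.LatticeModels.TorusSite 2 L × ZMod M), F (fun w => θ (sh s w))
    let cube : Set ((Literature.Probability.LatticeModels.TorusSite 2 L × ZMod M) → ℝ) := Set.pi Set.univ (fun _ => Set.Icc (0:ℝ) (2 * Real.pi))
    let Z : ℂ := MeasureTheory.integral (MeasureTheory.volume.restrict cube) (fun θ => Complex.exp (-(A θ)))
    Z ≠ 0 := by
  intro r K hK c hc L M _ _
  exact cplxFerro_partZ_ne_zero K hK c hc L M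

/-! ### The disprover's genuinely complex class member lies in the cone -/

/-- Coefficients of `cosTab u v` (`1 - cos(φ_u - φ_v)`): real, and `≤ 0` off the constant mode. -/
theorem cplxFerro_cosTab_apply (u v : W 2) (n : Freq 2) :
    (cosTab u v n).im = 0 ∧ (n ≠ 0 → (cosTab u v n).re ≤ 0) := by
  simp only [cosTab, Finsupp.add_apply, Finsupp.single_apply]
  refine ⟨?_, fun hn => ?_⟩
  · split_ifs <;> norm_num
  · have h0 : ¬ ((0 : Freq 2) = n) := fun h => hn h.symm
    simp only [h0, if_false, zero_add]
    split_ifs <;> norm_num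

/-- Coefficients of `cosTab u v + (iε₂) • sinTab u v` (`1 - cos Δφ + iε₂ sin Δφ`, `Δφ = φ_u - φ_v`): real
(`-(1∓ε₂)/2` on `±(δ_u - δ_v)`, `1` on `0`), and `≤ 0` off the constant mode when `|ε₂| ≤ 1`. -/
theorem cplxFerro_cosTab_add_sinTab_apply {ε₂ : ℝ} (hε : |ε₂| ≤ 1) (u v : W 2) (n : Freq 2) :
    (cosTab u v n).im + (((Complex.I * ε₂) • sinTab u v) n).im = 0 ∧
    (n ≠ 0 → (cosTab u v n).re + (((Complex.I * ε₂) • sinTab u v) n).re ≤ 0) := by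
  obtain ⟨h1, h2⟩ := abs_le.1 hε
  simp only [cosTab, sinTab, Finsupp.add_apply, Finsupp.smul_apply, Finsupp.single_apply, smul_eq_mul]
  refine ⟨?_, fun hn => ?_⟩
  · split_ifs <;> simp
  · have h0 : ¬ ((0 : Freq 2) = n) := fun h => hn h.symm
    simp only [h0, if_false, zero_add]
    split_ifs <;> simp <;> nlinarith

/-- **The Berry-tilted XY table is Fourier-negative for `|ε₂| ≤ 1`**: every coefficient of `witness 0 ε₂` is
real, and every non-constant one is `≤ 0` (temporal bonds carry `-(1∓ε₂)/2`, spatial bonds `-1/2`). -/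
theorem tiltedXY_mem_complexFerroCone {ε₂ : ℝ} (hε : |ε₂| ≤ 1) (n : Freq 2) :
    ((witness 0 ε₂) n).im = 0 ∧ (n ≠ 0 → ((witness 0 ε₂) n).re ≤ 0) := by
  -- regroup the temporal cosine and sine tables edge by edge
  have hw : witness 0 ε₂ = spatialTab +
      (temporalEdges.map fun e => cosTab e.1 e.2 + (Complex.I * ε₂) • sinTab e.1 e.2).sum := by
    simp only [witness, temporalCosTab, temporalSinTab, temporalEdges, List.map_cons, List.map_nil,
      List.sum_cons, List.sum_nil, Complex.ofReal_zero, mul_zero, add_zero, one_smul, smul_add]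
    abel
  have hS := fun e : W 2 × W 2 => cplxFerro_cosTab_apply e.1 e.2 n
  have hT := fun e : W 2 × W 2 => cplxFerro_cosTab_add_sinTab_apply hε e.1 e.2 n
  rw [hw]
  simp only [spatialTab, spatialEdges, temporalEdges, List.map_cons, List.map_nil, List.sum_cons,
    List.sum_nil, Finsupp.coe_add, Pi.add_apply, add_zero, Complex.add_re, Complex.add_im]
  refine ⟨?_, fun hn => ?_⟩
  · have e1 := (hS (vx 1 0 0, vx 0 0 0)).1; have e2 := (hS (vx 1 0 1, vx 0 0 1)).1
    have e3 := (hS (vx 1 1 0, vx 0 1 0)).1; have e4 := (hS (vx 1 1 1, vx 0 1 1)).1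
    have e5 := (hS (vx 0 1 0, vx 0 0 0)).1; have e6 := (hS (vx 0 1 1, vx 0 0 1)).1
    have e7 := (hS (vx 1 1 0, vx 1 0 0)).1; have e8 := (hS (vx 1 1 1, vx 1 0 1)).1
    have t1 := (hT (vx 0 0 1, vx 0 0 0)).1; have t2 := (hT (vx 0 1 1, vx 0 1 0)).1
    have t3 := (hT (vx 1 0 1, vx 1 0 0)).1; have t4 := (hT (vx 1 1 1, vx 1 1 0)).1
    simp only at e1 e2 e3 e4 e5 e6 e7 e8 t1 t2 t3 t4
    linarith
  · have e1 := (hS (vx 1 0 0, vx 0 0 0)).2 hn; have e2 := (hS (vx 1 0 1, vx 0 0 1)).2 hn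
    have e3 := (hS (vx 1 1 0, vx 0 1 0)).2 hn; have e4 := (hS (vx 1 1 1, vx 0 1 1)).2 hn
    have e5 := (hS (vx 0 1 0, vx 0 0 0)).2 hn; have e6 := (hS (vx 0 1 1, vx 0 0 1)).2 hn
    have e7 := (hS (vx 1 1 0, vx 1 0 0)).2 hn; have e8 := (hS (vx 1 1 1, vx 1 0 1)).2 hn
    have t1 := (hT (vx 0 0 1, vx 0 0 0)).2 hn; have t2 := (hT (vx 0 1 1, vx 0 1 0)).2 hn
    have t3 := (hT (vx 1 0 1, vx 1 0 0)).2 hn; have t4 := (hT (vx 1 1 1, vx 1 1 0)).2 hn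
    simp only at e1 e2 e3 e4 e5 e6 e7 e8 t1 t2 t3 t4
    linarith

/-- **The disprover's genuinely complex class member has a positive partition function at every stiffness and
volume**: for `|ε₂| ≤ 1`, `K ≥ 0` and all `L, M ≥ 1`, `0 < Re Z` and `Im Z = 0` for the Berry-tilted XY table
`witness 0 ε₂` (in the (U1)(N)(A)(C)(R)(P) class of the crux for `|ε₂| ≤ 1/5`, with non-real `F` for `ε₂ ≠ 0`).
[cite: Ginibre1970, main theorem with the plane-rotator example] -/
theorem cplxFerro_re_partZ_tiltedXY_pos {ε₂ : ℝ} (hε : |ε₂| ≤ 1) (K : ℝ) (hK : 0 ≤ K)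
    (L M : ℕ) [NeZero L] [NeZero M] :
    0 < (partZ K (witness 0 ε₂) L M).re ∧ (partZ K (witness 0 ε₂) L M).im = 0 :=
  cplxFerro_re_partZ_pos K hK (witness 0 ε₂) (fun n hn => ⟨(tiltedXY_mem_complexFerroCone hε n).1,
    (tiltedXY_mem_complexFerroCone hε n).2 hn⟩) (tiltedXY_mem_complexFerroCone hε 0).1 L M

/-- Summary for the crux's class: the tilted witness at `|ε₂| ≤ 1/5` satisfies all six hypotheses of
`BirComplexStableXYR` (at `r = 2`, `B = 128`, `c₀ = 1/18`), is non-real for `ε₂ ≠ 0`, and has `Z ≠ 0` with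
`0 < Re Z` for EVERY `K ≥ 0`, `L`, `M` — conclusion 1 of the crux on the only explicit complex inhabitant of the
class, with no threshold and no parity. [cite: Ginibre1970, main theorem with the plane-rotator example] -/
theorem cplxFerro_tiltedXY_summary {ε₂ : ℝ} (hε : |ε₂| ≤ 1/5) (hε0 : ε₂ ≠ 0) :
    ((∀ m ∈ (witness 0 ε₂).support, ∑ w, m w = 0) ∧
      (witness 0 ε₂).sum (fun _ a => a) = 0 ∧
      (witness 0 ε₂).sum (fun n a => ‖a‖ * Real.exp (∑ w, |(n w : ℝ)|)) ≤ 128 ∧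
      (∀ φ : W 2 → ℝ, (1/18 : ℝ) * ∑ w, ∑ w', (1 - Real.cos (φ w - φ w')) ≤ (genF (witness 0 ε₂) φ).re) ∧
      (∀ n : Freq 2, witness 0 ε₂ (fun w => n (w.1, w.2.1, Fin.rev w.2.2)) = (starRingEnd ℂ) (witness 0 ε₂ (-n))) ∧
      (∀ n : Freq 2, witness 0 ε₂ (fun w => n (Fin.rev w.1, Fin.rev w.2.1, w.2.2)) = witness 0 ε₂ n)) ∧
    (∃ φ : W 2 → ℝ, (genF (witness 0 ε₂) φ).im ≠ 0) ∧
    (∀ (K : ℝ), 0 ≤ K → ∀ (L M : ℕ) [NeZero L] [NeZero M],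
      partZ K (witness 0 ε₂) L M ≠ 0 ∧ 0 < (partZ K (witness 0 ε₂) L M).re) := by
  have hε1 : |ε₂| ≤ 1 := hε.trans (by norm_num)
  refine ⟨BirComplexStableXYR.Negative.tiltedXY_mem_classRP hε,
    BirComplexStableXYR.Negative.genF_tiltedXY_not_real hε0, fun K hK L M _ _ => ?_⟩
  have h := cplxFerro_re_partZ_tiltedXY_pos hε1 K hK L M
  exact ⟨fun hz => by simpa [hz] using h.1, h.1⟩

end ComplexFerroCone

end Summit.HubbardSuperconductivity.HubbardSuperconductivity.Theorems

end
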